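import Summits.Ventures.WeilGRH.BaseRungEvenTransfer
import Literature.NumberTheory.LFunctions.WeilExplicitRightEdge
import Literature.Analysis.SpecialFunctions.DigammaReflection
import Literature.Analysis.SpecialFunctions.DigammaLogBound
import Mathlib.Analysis.Complex.Trigonometric
import HarnessLib

/-!
# The base rung of the GRH arm for ODD characters (transfer from the `ζ`-side), hence for ALL
# Dirichlet characters mod `q ≥ 5`: `WeilPositivityOnChar χ ((log 2)/2)`

Cell `rh-explicit`, WEIL TRACK — GRH ARM; lead ruling R7-8 (one writer per object: even transfer =
`BaseRungEvenTransfer.lean` (weil-grh-2), odd transfer = this file (weil-grh-1)).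

On the prime-free window `2a ≤ log 2`, for a Dirichlet character `χ` mod `q ≠ 1` of parity `κ`
(`weilQuadraticChar_eq_arch_of_tsupport_subset` of the base file `WeilExplicitDirichlet.lean`):
`Re Q_χ(g) = (1/2π) A_κ(g) + (log q − log π)‖g‖₂²`, `A_κ(g) = ∫ |ĝ(1/2+it)|² Re ψ(1/4 + κ/2 + it/2) dt`,
while Yoshida's analytic form of the `ζ` rung is `E(g) = 2 Re(ĝ(0) conj ĝ(1)) − (log π)‖g‖₂² + (1/2π)A₀(g)`
(`weilArchQuadratic`, PROVED `≥ 0` for `supp g ⊆ [−(log 2)/2, (log 2)/2]`: `weilArchQuadratic_nonneg`).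
Hence for ODD `χ`:
`Re Q_χ(g) = E(g) − 2 Re(ĝ(0) conj ĝ(1)) + (log q)‖g‖₂² + (1/2π)(A₁(g) − A₀(g))`.
The even file bounds the polar term, `2 Re(ĝ(0) conj ĝ(1)) ≤ 2(sinh a + a)‖g‖₂²` (`weilPolar_re_le`);
the new ingredient here is the PARITY TERM `A₁(g) − A₀(g) ≥ 0`: pointwise
`Re ψ(3/4 + iy) − Re ψ(1/4 + iy) = Re[π cot(π/4 + iπy)] = π/(cosh²(πy) + sinh²(πy)) > 0`
by the reflection formula `ψ(1 − s) − ψ(s) = π cot(πs)` (the tree's `digamma_one_sub_sub_digamma`,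
`Literature/Analysis/SpecialFunctions/DigammaReflection.lean`) at `s = 1/4 + iy`, with
`1 − s = conj(3/4 + iy)` and `cos(π/4) = sin(π/4)`; integrability of `|ĝ|² Re ψ(x + it/2)` (`x > 0`)
is the usual decay-vs-log bound (`integrable_mul_weilMellin_vertical_of_norm_le_log`,
`exists_norm_digamma_vertical_le`).  RESULTS:
* `weilPositivityOnChar_of_odd`: `q ≠ 1`, `χ.Odd`, `2a ≤ log 2`, `2(sinh a + a) ≤ log q` ⟹
  `WeilPositivityOnChar χ a`;
* `weilPositivityOnChar_log_two_half_of_odd (hq : 5 ≤ q) (χ) (hχ : χ.Odd)` — the base rung;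
* with weil-grh-2's even theorem: `weilPositivityOnChar_log_two_half (hq : 5 ≤ q) (χ)` for EVERY
  Dirichlet character mod `q ≥ 5`, and every window `a ≤ (log 2)/2`.
No named fact is used (the rung predicates are definitions; primitivity is not needed).  The only
first-rung cells of the `q ≤ 20` grid not covered by transfer are `q ∈ {3, 4}` (`3.2`, `4.3`), where
`log q < 1/√2 + log 2`; those are certificate cells.
-/

noncomputable section

open Complex Filter Set MeasureTheory
open scoped Real Topology ComplexConjugate

namespace Summit.Ventures.WeilGRH

open Literature.NumberTheory.LFunctions

variable {q : ℕ} {g : ℝ → ℂ}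

section Odd

open Literature.Analysis.SpecialFunctions.Complex in
/-- **`Re ψ(1/4 + iy) ≤ Re ψ(3/4 + iy)`** for every real `y`: by the reflection formula
`ψ(1 − s) − ψ(s) = π cot(πs)` at `s = 1/4 + iy` (where `1 − s = conj(3/4 + iy)`) the difference is
`Re π cot(π/4 + iπy) = π/(cosh²(πy) + sinh²(πy)) = π/cosh(2πy) > 0` (`cos(π/4) = sin(π/4)`). [folklore] -/
theorem re_digamma_quarter_le_three_quarters (y : ℝ) :
    (Complex.digamma (1 / 4 + y * I)).re ≤ (Complex.digamma (3 / 4 + y * I)).re := by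
  set s : ℂ := 1 / 4 + y * I with hs_def
  have hs : ∀ n : ℤ, s ≠ n := by
    intro n h
    have h1 := congrArg Complex.re h
    simp only [hs_def, add_re, div_ofNat_re, one_re, mul_re, ofReal_re, I_re, mul_zero, ofReal_im,
      I_im, mul_one, sub_self, add_zero, intCast_re] at h1
    have h2 : (4 : ℝ) * n = 1 := by linarith
    have h3 : (4 : ℤ) * n = 1 := by exact_mod_cast h2
    omega
  have href := digamma_one_sub_sub_digamma hs
  have h1s : (1 : ℂ) - s = conj (3 / 4 + y * I) := by
    simp only [hs_def, map_add, map_div₀, map_ofNat, map_mul, Complex.conj_ofReal, Complex.conj_I]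
    ring
  rw [h1s, Literature.NumberTheory.LFunctions.digamma_conj] at href
  have hre := congrArg Complex.re href
  simp only [sub_re, conj_re] at hre
  -- the right-hand side is `≥ 0`
  suffices h : 0 ≤ (↑π * Complex.cos (↑π * s) / Complex.sin (↑π * s)).re by linarith
  have hπs : (π : ℂ) * s = ((π / 4 : ℝ) : ℂ) + ((π * y : ℝ) : ℂ) * I := by
    simp only [hs_def]; push_cast; ring
  rw [hπs, Complex.cos_add_mul_I, Complex.sin_add_mul_I, ← Complex.ofReal_cos, ← Complex.ofReal_sin,
    ← Complex.ofReal_cosh, ← Complex.ofReal_sinh, Real.cos_pi_div_four, Real.sin_pi_div_four]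
  set ch : ℝ := Real.cosh (π * y)
  set sh : ℝ := Real.sinh (π * y)
  have hc0 : ((Real.sqrt 2 / 2 : ℝ) : ℂ) ≠ 0 :=
    Complex.ofReal_ne_zero.2 (by positivity)
  have hw : ((Real.sqrt 2 / 2 : ℝ) : ℂ) * (ch : ℂ) + ((Real.sqrt 2 / 2 : ℝ) : ℂ) * (sh : ℂ) * I =
      ((Real.sqrt 2 / 2 : ℝ) : ℂ) * ((ch : ℂ) + (sh : ℂ) * I) := by ring
  have hz : (π : ℂ) * (((Real.sqrt 2 / 2 : ℝ) : ℂ) * (ch : ℂ) - ((Real.sqrt 2 / 2 : ℝ) : ℂ) * (sh : ℂ) * I) =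
      ((Real.sqrt 2 / 2 : ℝ) : ℂ) * ((π : ℂ) * ((ch : ℂ) - (sh : ℂ) * I)) := by ring
  rw [hz, hw, mul_div_mul_left _ _ hc0, Complex.div_re]
  have hch : ch ^ 2 = sh ^ 2 + 1 := Real.cosh_sq (π * y)
  have hnum1 : ((π : ℂ) * ((ch : ℂ) - (sh : ℂ) * I)).re = π * ch := by
    simp [mul_re, sub_re, mul_im]
  have hnum2 : ((π : ℂ) * ((ch : ℂ) - (sh : ℂ) * I)).im = -(π * sh) := by
    simp [mul_im, sub_im, mul_re]
  have hden1 : ((ch : ℂ) + (sh : ℂ) * I).re = ch := by simp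
  have hden2 : ((ch : ℂ) + (sh : ℂ) * I).im = sh := by simp
  rw [hnum1, hnum2, hden1, hden2, ← add_div]
  refine div_nonneg ?_ (Complex.normSq_nonneg _)
  nlinarith [Real.pi_pos, hch]

/-- The parity-`1` kernel dominates the parity-`0` kernel pointwise on the critical line:
`Re ψ(1/4 + it/2) ≤ Re ψ(1/4 + 1/2 + it/2)`. [folklore] -/
theorem re_digamma_par_zero_le_one (t : ℝ) :
    (Complex.digamma (1 / 4 + ((0 : ℕ) : ℂ) / 2 + t / 2 * I)).re ≤
      (Complex.digamma (1 / 4 + ((1 : ℕ) : ℂ) / 2 + t / 2 * I)).re := by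
  have h := re_digamma_quarter_le_three_quarters (t / 2)
  have e0 : (1 / 4 + ((0 : ℕ) : ℂ) / 2 + t / 2 * I) = 1 / 4 + ((t / 2 : ℝ) : ℂ) * I := by
    push_cast; ring
  have e1 : (1 / 4 + ((1 : ℕ) : ℂ) / 2 + t / 2 * I) = 3 / 4 + ((t / 2 : ℝ) : ℂ) * I := by
    push_cast; ring
  rw [e0, e1]
  exact h

/-- The archimedean integral of parity `a` at `g ⋆ g̃` is the real number
`∫ |ĝ(1/2 + it)|² Re ψ(1/4 + a/2 + it/2) dt`. [folklore] -/
theorem weilArchIntegralChar_weilConv_weilReflect (hg : IsWeilTest g) (a : ℕ) :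
    weilArchIntegralChar a (weilConv g (weilReflect g)) =
      ((∫ t : ℝ, ‖weilMellin g (1 / 2 + t * I)‖ ^ 2 *
        (Complex.digamma (1 / 4 + (a : ℂ) / 2 + t / 2 * I)).re : ℝ) : ℂ) := by
  unfold weilArchIntegralChar
  rw [← integral_complex_ofReal]
  congr 1 with t
  rw [weilMellin_weilConv_weilReflect_half hg]
  push_cast
  ring

open Literature.Analysis.SpecialFunctions.Complex in
/-- Integrability of the parity-shifted archimedean integrand `|ĝ(1/2+it)|² Re ψ(x + it/2)`, `x > 0`
(decay of `k̂ = |ĝ|²` on the critical line against logarithmic growth of `ψ`; as the tree's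
`integrable_weilArchIntegrand`). [folklore] -/
theorem integrable_normSq_mul_re_digamma (hg : IsWeilTest g) {x : ℝ} (hx : 0 < x) :
    Integrable fun t : ℝ ↦ ‖weilMellin g (1 / 2 + t * I)‖ ^ 2 *
      (Complex.digamma (x + t / 2 * I)).re := by
  have hk : IsWeilTest (weilConv g (weilReflect g)) := hg.weilConv hg.weilReflect
  obtain ⟨C, hC⟩ := exists_norm_digamma_vertical_le hx
  set F : ℝ → ℂ := fun t ↦ ((Complex.digamma (x + t / 2 * I)).re : ℂ) with hF
  have hw : ∀ t : ℝ, (x : ℂ) + (t : ℂ) / 2 * I = (x : ℂ) + ((t / 2 : ℝ) : ℂ) * I := by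
    intro t; push_cast; ring
  have hFc : Continuous F := by
    refine continuous_ofReal.comp (Complex.continuous_re.comp ?_)
    refine continuousOn_digamma.comp_continuous (by fun_prop) fun t ↦ ?_
    rw [hw t]
    simpa using hx
  have hFb : ∀ t : ℝ, ‖F t‖ ≤ C + Real.log (1 + |t|) := by
    intro t
    have h1 : ‖F t‖ ≤ ‖Complex.digamma (x + t / 2 * I)‖ := by
      simp only [hF, Complex.norm_real, Real.norm_eq_abs]
      exact Complex.abs_re_le_norm _
    have h2 := hC (t / 2)
    rw [← hw t] at h2
    have h3 : Real.log (1 + |t / 2|) ≤ Real.log (1 + |t|) := by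
      refine Real.log_le_log (by positivity) ?_
      rw [abs_div, abs_two]
      linarith [abs_nonneg t]
    linarith
  have hI := integrable_mul_weilMellin_vertical_of_norm_le_log hk (1 / 2) hFc hFb
  have hI' : Integrable fun t : ℝ ↦ ((‖weilMellin g (1 / 2 + t * I)‖ ^ 2 *
      (Complex.digamma (x + t / 2 * I)).re : ℝ) : ℂ) := by
    refine hI.congr (Eventually.of_forall fun t ↦ ?_)
    simp only [hF]
    have : ((1 / 2 : ℝ) : ℂ) + (t : ℂ) * I = 1 / 2 + (t : ℂ) * I := by push_cast; ring
    rw [this, weilMellin_weilConv_weilReflect_half hg]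
    push_cast
    ring
  exact hI'.re.congr (Eventually.of_forall fun t ↦ by simp only [RCLike.re_to_complex, Complex.ofReal_re])

/-- **The parity term is non-negative**:
`∫ |ĝ(1/2+it)|² Re ψ(1/4 + it/2) dt ≤ ∫ |ĝ(1/2+it)|² Re ψ(3/4 + it/2) dt`. [folklore] -/
theorem arch_integral_par_zero_le_one (hg : IsWeilTest g) :
    ∫ t : ℝ, ‖weilMellin g (1 / 2 + t * I)‖ ^ 2 *
        (Complex.digamma (1 / 4 + ((0 : ℕ) : ℂ) / 2 + t / 2 * I)).re ≤
      ∫ t : ℝ, ‖weilMellin g (1 / 2 + t * I)‖ ^ 2 *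
        (Complex.digamma (1 / 4 + ((1 : ℕ) : ℂ) / 2 + t / 2 * I)).re := by
  have h0 := integrable_normSq_mul_re_digamma hg (x := 1 / 4) (by norm_num)
  have h1 := integrable_normSq_mul_re_digamma hg (x := 3 / 4) (by norm_num)
  have e0 : ∀ t : ℝ, (1 / 4 + ((0 : ℕ) : ℂ) / 2 + t / 2 * I) = ((1 / 4 : ℝ) : ℂ) + t / 2 * I := by
    intro t; push_cast; ring
  have e1 : ∀ t : ℝ, (1 / 4 + ((1 : ℕ) : ℂ) / 2 + t / 2 * I) = ((3 / 4 : ℝ) : ℂ) + t / 2 * I := by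
    intro t; push_cast; ring
  simp_rw [e0, e1]
  refine integral_mono h0 h1 fun t ↦ ?_
  have := re_digamma_par_zero_le_one t
  rw [e0, e1] at this
  exact mul_le_mul_of_nonneg_left this (by positivity)

/-- On the prime-free window and for an ODD character mod `q ≠ 1`:
`Re Q_χ(g) = E(g) − 2 Re(ĝ(0) conj ĝ(1)) + (log q) ‖g‖₂² + (1/2π)(A₁ − A₀)` with
`A_a = ∫ |ĝ(1/2+it)|² Re ψ(1/4 + a/2 + it/2) dt`, `A₁ − A₀ ≥ 0`. [folklore] -/
theorem re_weilQuadraticChar_of_odd (hq : q ≠ 1) [NeZero q] {χ : DirichletCharacter ℂ q}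
    (hχ : χ.Odd) (hg : IsWeilTest g) {a : ℝ} (hsupp : tsupport g ⊆ Icc (-a) a)
    (ha : 2 * a ≤ Real.log 2) :
    (weilQuadraticChar χ g).re =
      weilArchQuadratic g - 2 * (weilMellin g 0 * conj (weilMellin g 1)).re +
        Real.log q * (∫ t : ℝ, ‖g t‖ ^ 2) +
        1 / (2 * π) * ((∫ t : ℝ, ‖weilMellin g (1 / 2 + t * I)‖ ^ 2 *
            (Complex.digamma (1 / 4 + ((1 : ℕ) : ℂ) / 2 + t / 2 * I)).re) -
          ∫ t : ℝ, ‖weilMellin g (1 / 2 + t * I)‖ ^ 2 *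
            (Complex.digamma (1 / 4 + ((0 : ℕ) : ℂ) / 2 + t / 2 * I)).re) := by
  rw [weilQuadraticChar_eq_arch_of_tsupport_subset hq hg hsupp ha, charParity_of_odd hχ,
    weilArchTermChar, weilArchIntegralChar_weilConv_weilReflect hg,
    weilConv_weilReflect_apply_zero, weilArchQuadratic]
  have hπ : ((1 / (2 * π) : ℂ)) = ((1 / (2 * π) : ℝ) : ℂ) := by push_cast; ring
  have e0 : ∀ t : ℝ, (1 / 4 + ((0 : ℕ) : ℂ) / 2 + t / 2 * I) = 1 / 4 + t / 2 * I := by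
    intro t; push_cast; ring
  simp_rw [e0]
  rw [hπ]
  simp only [← Complex.ofReal_mul, ← Complex.ofReal_add, Complex.ofReal_re, Complex.mul_re]
  ring

/-- **TRANSFER THEOREM (odd characters, prime-free window).** `q ≠ 1`, `χ` odd, `2a ≤ log 2`,
`2(sinh a + a) ≤ log q` ⟹ `WeilPositivityOnChar χ a`. [folklore] -/
theorem weilPositivityOnChar_of_odd (hq : q ≠ 1) [NeZero q] {χ : DirichletCharacter ℂ q}
    (hχ : χ.Odd) {a : ℝ} (ha : 2 * a ≤ Real.log 2) (hqa : 2 * (Real.sinh a + a) ≤ Real.log q) :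
    WeilPositivityOnChar χ a := by
  intro g hg hsupp
  have hsupp' : tsupport g ⊆ Icc (-(Real.log 2 / 2)) (Real.log 2 / 2) :=
    hsupp.trans (Icc_subset_Icc (by linarith) (by linarith))
  have hE : 0 ≤ weilArchQuadratic g :=
    weilPositivityOn_log_two_half_iff.1 weilPositivityOn_log_two_half_holds g hg hsupp'
  have hP := weilPolar_re_le hg hsupp
  have hN : 0 ≤ ∫ t : ℝ, ‖g t‖ ^ 2 := integral_nonneg fun t ↦ by positivity
  have hA := arch_integral_par_zero_le_one hg
  have hπ : 0 ≤ 1 / (2 * π) := by positivity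
  rw [re_weilQuadraticChar_of_odd hq hχ hg hsupp ha]
  nlinarith [mul_le_mul_of_nonneg_right hqa hN, mul_nonneg hπ (sub_nonneg.2 hA)]

/-- **The base rung of the GRH arm for odd characters**: every odd Dirichlet character mod
`q ≥ 5` satisfies `WeilPositivityOnChar χ ((log 2)/2)` (`2(sinh((log 2)/2) + (log 2)/2) =
1/√2 + log 2 < log 5 ≤ log q`, the even file's numerics). [folklore] -/
theorem weilPositivityOnChar_log_two_half_of_odd (hq : 5 ≤ q) (χ : DirichletCharacter ℂ q)
    (hχ : χ.Odd) : WeilPositivityOnChar χ (Real.log 2 / 2) := by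
  have hq1 : q ≠ 1 := by omega
  haveI : NeZero q := ⟨by omega⟩
  refine weilPositivityOnChar_of_odd hq1 hχ (by linarith) ?_
  rw [two_mul_sinh_log_two_half_add]
  refine inv_sqrt_two_add_log_two_lt_log_five.le.trans (Real.log_le_log (by norm_num) ?_)
  exact_mod_cast hq

/-- **The base rung of the GRH arm for EVERY Dirichlet character mod `q ≥ 5`** (even: weil-grh-2's
`weilPositivityOnChar_log_two_half_of_even`; odd: above). [folklore] -/
theorem weilPositivityOnChar_log_two_half (hq : 5 ≤ q) (χ : DirichletCharacter ℂ q) :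
    WeilPositivityOnChar χ (Real.log 2 / 2) := by
  haveI : NeZero q := ⟨by omega⟩
  rcases χ.even_or_odd with h | h
  · exact weilPositivityOnChar_log_two_half_of_even hq χ h
  · exact weilPositivityOnChar_log_two_half_of_odd hq χ h

/-- … and every window `a ≤ (log 2)/2`, `q ≥ 5`, any parity. [folklore] -/
theorem weilPositivityOnChar_of_le_log_two_half (hq : 5 ≤ q) (χ : DirichletCharacter ℂ q)
    {a : ℝ} (ha : a ≤ Real.log 2 / 2) : WeilPositivityOnChar χ a :=
  (weilPositivityOnChar_log_two_half hq χ).mono ha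

end Odd

end Summit.Ventures.WeilGRH

end
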